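import Summits.BirchSwinnertonDyer.BirchSwinnertonDyer.Theorems.ByReductionTypeAtTwoSupersingularFlatColemanLevelZero
import Summits.BirchSwinnertonDyer.BirchSwinnertonDyer.Theorems.ByReductionTypeAtTwoSupersingularTowerTorsionTwo
import Literature.NumberTheory.EllipticCurves.Sprung2012.ColemanMapSurjectiveProofs
import HarnessLib

/-!
# Route `ByReductionTypeAtTwo` (rung K4), crux `SupersingularRankZeroAtTwo` (item stmt-BirchSwinnertonDyer-19097), line
# `odd_blind_package` v2.13, stub 5 `stub_flatKernelCyclic`, sub-hand h13a: **AT `p = 2` a tower functional with `2 ∤ z(c₀)` EXISTS from the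
# registry's level-`0` clauses alone** (Sprung 2012, proof of Prop. 7.3, ported to `p = 2` with the cell's Lemma 2.3 at `2`), hence
# **`Ker Col♭ = Λ ∙ z♭` for EVERY datum of the registry modulo ONE displayed input `e : H¹_Iw(ℚ₂, T₂E) ≃ₗ[Λ] Λ²`**
# (cell `bsd-2adic`, LEAD ss-1 GEN 23; `--supports 19097`, helper)

HONEST FRAMING: THEOREMS ONLY (no definition, no named fact, no `sorry`, no instance).  Nothing about any curve's Selmer group; 19097 OPEN;
BSD is proved for no curve.  h13a(ii) (`Col` linear, ★ p823375) and h13a(iii) (this file) are now KERNEL; h13a(i) (`e`, Greenberg 1989 §3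
Cor. 2 in the functional model) and h13b (the Kummer pairing, consumer ★ p823268) remain with the t42 lineage.

* `exists_addMonoidHom_layer_zero_not_two_dvd` — `Hom(E(ℚ_v), ℤ₂)` has an element with a value not divisible by `2` (`v ∋ 2` good
  supersingular): Sprung's `exists_addMonoidHom_layer_zero_not_dvd` with `p ↦ 2`, its `p ≠ 2` input (no `p`-torsion on the bottom layer,
  Lemma 2.3) replaced by the cell's `SSFlatEC.eq_zero_of_mem_localTowerPointsOfEmb_of_two_nsmul` (Lemma 2.3 AT `2`: `Ẽ(𝔽₂)` odd, height-`2`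
  formal group); `E(ℚ_v) ≠ 2E(ℚ_v)` by `Sprung2012.exists_point_forall_nsmul_ne` (Milne I Lemma 3.3, any `p`).
* `exists_addMonoidHom_not_two_dvd_apply` — for `c₀ ∈ E(ℚ_v)` with the registry's INJECTIVITY clause `hz` (`z₀(c₀) = 0 → z₀ = 0`) and
  SATURATION clause `hsat` (`z₀(c₀) ∈ 2ℤ₂·a`-lifting), some functional `z` on `E(ℚ_∞·ℚ_v)` has `2 ∤ z(c₀)`: Sprung's
  `exists_addMonoidHom_not_dvd_apply_cneg` with `c₋₁ ↦ c₀`, `p ↦ 2` (Pontryagin separation on the `2`-torsion-free tower; the layer is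
  `2`-saturated in the tower, `mem_localLayerPointsOfEmb_of_pow_nsmul_mem`).
* ★★ `exists_colemanKer_flat_eq_span_of_linearEquiv_fin_two_rat` — for `W/ℚ` good supersingular at `2`, the cyclotomic data, `v ∋ 2`, and EVERY
  `(g, c)` with the registry's clauses `hg`, `hc`, `htr`, `hz`, `hsat`: GIVEN `e : H¹_Iw ≃ₗ[Λ] Λ²`, `Ker Col♭ = Λ ∙ z♭`
  (★ `…_of_apply_ne_zero` of `…FlatColemanLevelZero` + the two lemmas above).  NO Honda clause is needed for this half of h13.

References: [Sprung2012] Lemma 2.3, Thm. 2.2 (p. 1487), proof of Prop. 7.3 (p. 1500), Def. 7.9; [MilneADT2006] I Lemma 3.3; [KitajimaOtsuki2018] Prop. 3.29, 3.32.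
-/

set_option autoImplicit false
-- the Theorems namespace of this sub repeats the summit name by design (D-0017 nested layout)
set_option linter.dupNamespace false

noncomputable section

open scoped Classical NumberField

open NumberField IsDedekindDomain Polynomial WeierstrassCurve Literature.NumberTheory.EllipticCurves
  Literature.NumberTheory.EllipticCurves.ZpExtension Literature.NumberTheory.EllipticCurves.Sprung2017
  Literature.NumberTheory.EllipticCurves.Kobayashi2003 Literature.NumberTheory.EllipticCurves.Sprung2012
  Literature.NumberTheory.GaloisRepresentations Literature.NumberTheory.EllipticCurves.Rank1Residual

namespace Summit.BirchSwinnertonDyer.BirchSwinnertonDyer.Theorems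

namespace OddBlindNF

variable (W : WeierstrassCurve ℚ) [W.IsElliptic] [W.IsGloballyMinimal] {v : HeightOneSpectrum (𝓞 ℚ)}

/-- An element of `ℤ₂` divisible by every power of `2` is `0` (copy of the private helper of Sprung's file). [folklore] -/
theorem padicInt_eq_zero_of_forall_two_pow_dvd {x : ℤ_[2]} (h : ∀ k : ℕ, (2 : ℤ_[2]) ^ k ∣ x) : x = 0 := by
  by_contra hx
  have h' : ∀ k : ℕ, ((2 : ℕ) : ℤ_[2]) ^ k ∣ x := fun k ↦ by exact_mod_cast h k
  have := (PadicInt.mem_span_pow_iff_le_valuation x hx (x.valuation + 1)).mp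
    (Ideal.mem_span_singleton.mpr (h' _))
  omega

/-- **`Hom(E(ℚ_v), ℤ₂)` has an element with a value not divisible by `2`** (`v ∋ 2` good supersingular; any `ℤ₂`-extension `κ` of `ℚ`,
any embedding `ι`): `E(ℚ_v) ≠ 2E(ℚ_v)` (Milne I Lemma 3.3), Galois descent to the bottom layer, no `2`-torsion there (Lemma 2.3 at `2`),
Pontryagin separation.  Port of `Sprung2012.exists_addMonoidHom_layer_zero_not_dvd` to `p = 2`.
[cite: Sprung2012, proof of Prop. 7.3 (p. 1500) and Lemma 2.3 (p. 1487)] [cite: MilneADT2006, I Lemma 3.3] -/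
theorem exists_addMonoidHom_layer_zero_not_two_dvd (hss : GoodSS W 2) (κ : ZpExtension ℚ 2)
    (hv : (2 : 𝓞 ℚ) ∈ v.asIdeal) (ι : AlgebraicClosure ℚ →ₐ[ℚ] AlgebraicClosure (v.adicCompletion ℚ)) :
    ∃ (z : localLayerPointsOfEmb κ ι W 0 →+ ℤ_[2]) (x : localLayerPointsOfEmb κ ι W 0), ¬ (2 : ℤ_[2]) ∣ z x := by
  haveI : PerfectField (v.adicCompletion ℚ) := by
    haveI : CharZero (v.adicCompletion ℚ) :=
      charZero_of_injective_algebraMap (algebraMap ℚ _).injective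
    infer_instance
  have hpv : ((2 : ℕ) : 𝓞 ℚ) ∈ v.asIdeal := by exact_mod_cast hv
  obtain ⟨P₀, hP₀⟩ := exists_point_forall_nsmul_ne W 2 hpv
  set x : localPoints W (v.adicCompletion ℚ) :=
    (localPointsEquivBaseChange W (v.adicCompletion ℚ)).symm
      (WeierstrassCurve.toGeomPoints (W.baseChange (v.adicCompletion ℚ)) P₀) with hxdef
  have hex : localPointsEquivBaseChange W (v.adicCompletion ℚ) x =
      WeierstrassCurve.toGeomPoints (W.baseChange (v.adicCompletion ℚ)) P₀ := by
    rw [hxdef, AddEquiv.apply_symm_apply]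
  have hx0 : x ∈ localLayerPointsOfEmb κ ι W 0 := by
    rw [mem_localLayerPointsOfEmb_zero_iff]
    intro τ
    apply (localPointsEquivBaseChange W (v.adicCompletion ℚ)).injective
    rw [localPointsEquivBaseChange_smul, hex, WeierstrassCurve.smul_toGeomPoints]
  -- the bottom layer has no `2`-torsion (Lemma 2.3 at `2`)
  have hN : ∀ y : localLayerPointsOfEmb κ ι W 0, 2 • y = 0 → y = 0 := fun y hy ↦ by
    apply Subtype.ext
    exact SSFlatEC.eq_zero_of_mem_localTowerPointsOfEmb_of_two_nsmul W hss κ hv ι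
      (localLayerPointsOfEmb_le_localTowerPointsOfEmb κ ι W 0 y.2)
      (by rw [← AddSubgroupClass.coe_nsmul, hy]; rfl)
  -- `x ∉ 2·E(ℚ_v)`
  have hx : ∀ y : localLayerPointsOfEmb κ ι W 0, 2 ^ 1 • y ≠ ⟨x, hx0⟩ := by
    intro y hy
    rw [pow_one] at hy
    have hyfix : ∀ τ : Field.absoluteGaloisGroup (v.adicCompletion ℚ),
        τ • localPointsEquivBaseChange W (v.adicCompletion ℚ) (y : localPoints W (v.adicCompletion ℚ)) =
          localPointsEquivBaseChange W (v.adicCompletion ℚ) (y : localPoints W (v.adicCompletion ℚ)) :=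
      fun τ ↦ by
        rw [← localPointsEquivBaseChange_smul, (mem_localLayerPointsOfEmb_zero_iff κ ι W _).mp y.2 τ]
    obtain ⟨P₁, hP₁⟩ := WeierstrassCurve.exists_toGeomPoints_eq_of_forall_smul_eq
      (W.baseChange (v.adicCompletion ℚ)) hyfix
    apply hP₀ P₁
    apply WeierstrassCurve.toGeomPoints_injective (W.baseChange (v.adicCompletion ℚ))
    have hy' : 2 • (y : localPoints W (v.adicCompletion ℚ)) = x := by
      rw [← AddSubgroupClass.coe_nsmul, hy]
    rw [map_nsmul, hP₁, ← map_nsmul, hy', hex]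
  obtain ⟨z, hz⟩ := Literature.Algebra.Module.exists_addMonoidHom_padicInt_not_dvd hN hx
  exact ⟨z, ⟨x, hx0⟩, by rwa [pow_one] at hz⟩

/-- **A functional `z` on `E(ℚ_∞·ℚ_v)` with `2 ∤ z(c₀)`**, from the registry's level-`0` clauses for `c₀ ∈ E(ℚ_v)` — INJECTIVITY
(`z₀(c₀) = 0 → z₀ = 0`) and SATURATION (`(∃ z₀, z₀(c₀) = 2a) → ∃ y, y(c₀) = a`): if every tower functional were divisible by `2` at `c₀`, then
`c₀ ∈ 2·E(ℚ_∞·ℚ_v)` (Pontryagin separation on the `2`-torsion-free tower), so `c₀ ∈ 2·E(ℚ_v)` (the layer is `2`-saturated in the tower),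
so every functional of `E(ℚ_v)` is divisible at `c₀` by `2`, by every `2ᵏ` (saturation), vanishes there and is `0` (injectivity) —
contradicting `exists_addMonoidHom_layer_zero_not_two_dvd`.  Port of `Sprung2012.exists_addMonoidHom_not_dvd_apply_cneg` (`c₋₁ ↦ c₀`, `p ↦ 2`).
[cite: Sprung2012, proof of Prop. 7.3 (p. 1500), Thm. 2.2 (p. 1487), Lemma 2.3 (p. 1487)] -/
theorem exists_addMonoidHom_not_two_dvd_apply (hss : GoodSS W 2) (κ : ZpExtension ℚ 2)
    (hv : (2 : 𝓞 ℚ) ∈ v.asIdeal) (ι : AlgebraicClosure ℚ →ₐ[ℚ] AlgebraicClosure (v.adicCompletion ℚ))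
    {c₀ : localPoints W (v.adicCompletion ℚ)} (hc₀ : c₀ ∈ localLayerPointsOfEmb κ ι W 0)
    (hinj : ∀ z₀ : localLayerPointsOfEmb κ ι W 0 →+ ℤ_[2],
      evalOn W (localLayerPointsOfEmb κ ι W 0) z₀ c₀ = 0 → z₀ = 0)
    (hsat : ∀ a : ℤ_[2],
      (∃ z₀ : localLayerPointsOfEmb κ ι W 0 →+ ℤ_[2], evalOn W (localLayerPointsOfEmb κ ι W 0) z₀ c₀ = 2 * a) →
      ∃ y : localLayerPointsOfEmb κ ι W 0 →+ ℤ_[2], evalOn W (localLayerPointsOfEmb κ ι W 0) y c₀ = a) :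
    ∃ z : localTowerPointsOfEmb κ ι W →+ ℤ_[2],
      ¬ (2 : ℤ_[2]) ∣ z ⟨c₀, localLayerPointsOfEmb_le_localTowerPointsOfEmb κ ι W 0 hc₀⟩ := by
  have hle := fun n ↦ localLayerPointsOfEmb_le_localTowerPointsOfEmb κ ι W n
  have hnt : ∀ P ∈ localTowerPointsOfEmb κ ι W, 2 • P = 0 → P = 0 :=
    fun P hP h2 ↦ SSFlatEC.eq_zero_of_mem_localTowerPointsOfEmb_of_two_nsmul W hss κ hv ι hP h2
  by_contra hall
  push Not at hall
  -- the tower has no `2`-torsion, so `c₀ ∈ 2·E(ℚ_∞·ℚ_v)`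
  have hN : ∀ y : localTowerPointsOfEmb κ ι W, 2 • y = 0 → y = 0 := fun y hy ↦ by
    apply Subtype.ext
    exact hnt _ y.2 (by rw [← AddSubgroupClass.coe_nsmul, hy]; rfl)
  obtain ⟨y, hy⟩ := Literature.Algebra.Module.exists_nsmul_eq_of_forall_addMonoidHom_padicInt_dvd hN
    (k := 1) (n := ⟨c₀, hle 0 hc₀⟩) (fun z ↦ by rw [pow_one]; exact hall z)
  rw [pow_one] at hy
  have hy' : 2 ^ 1 • (y : localPoints W (v.adicCompletion ℚ)) = c₀ := by
    rw [pow_one, ← AddSubgroupClass.coe_nsmul, hy]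
  -- hence `c₀ ∈ 2·E(ℚ_v)` (the layer is `2`-saturated in the `2`-torsion-free tower)
  have hy0 : (y : localPoints W (v.adicCompletion ℚ)) ∈ localLayerPointsOfEmb κ ι W 0 :=
    mem_localLayerPointsOfEmb_of_pow_nsmul_mem κ ι W hnt y.2 (by rw [hy']; exact hc₀)
  -- every functional of `E(ℚ_v)` is divisible by `2` at `c₀` …
  have hdiv : ∀ z' : localLayerPointsOfEmb κ ι W 0 →+ ℤ_[2], (2 : ℤ_[2]) ∣ evalOn W _ z' c₀ := by
    intro z'
    rw [evalOn_of_mem W _ z' hc₀]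
    have e : (⟨c₀, hc₀⟩ : localLayerPointsOfEmb κ ι W 0) =
        2 • ⟨(y : localPoints W (v.adicCompletion ℚ)), hy0⟩ := by
      apply Subtype.ext
      rw [AddSubgroupClass.coe_nsmul]
      change c₀ = 2 • (y : localPoints W (v.adicCompletion ℚ))
      rw [← hy', pow_one]
    rw [e, map_nsmul, nsmul_eq_mul]
    exact dvd_mul_right _ _
  -- … hence by every power of `2` (saturation clause) …
  have hpow : ∀ (k : ℕ) (z' : localLayerPointsOfEmb κ ι W 0 →+ ℤ_[2]), (2 : ℤ_[2]) ^ k ∣ evalOn W _ z' c₀ := by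
    intro k
    induction k with
    | zero => intro z'; rw [pow_zero]; exact one_dvd _
    | succ k ih =>
      intro z'
      obtain ⟨a, ha⟩ := hdiv z'
      obtain ⟨y', hy'⟩ := hsat a ⟨z', ha⟩
      obtain ⟨d, hd⟩ := ih y'
      rw [ha, ← hy', hd, pow_succ']
      exact ⟨d, by ring⟩
  -- … hence vanishes there, hence is `0` (injectivity clause): contradiction
  have hzero : ∀ z' : localLayerPointsOfEmb κ ι W 0 →+ ℤ_[2], z' = 0 := fun z' ↦
    hinj z' (padicInt_eq_zero_of_forall_two_pow_dvd (fun k ↦ hpow k z'))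
  obtain ⟨z', x, hzx⟩ := exists_addMonoidHom_layer_zero_not_two_dvd W hss κ hv ι
  exact hzx (by rw [hzero z', AddMonoidHom.zero_apply]; exact dvd_zero _)

/-- ★★ **h13a for EVERY datum of the registry, modulo ONE displayed input.**  For `W/ℚ` elliptic, globally minimal, good supersingular at `2`,
any `ℤ₂`-extension `κ`, `v ∋ 2`, the chosen embedding, and every `(g, c)` with the registry's clauses — `hg` (local lift of a generator), `hc`
(levels), `htr` (traces `n ≥ 1`), `hz` (injectivity at `c₀`), `hsat` (saturation at `c₀`) — GIVEN a `Λ`-linear isomorphism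
`e : H¹_Iw(ℚ₂, T₂E) ≃ Λ²` of the functional model (Greenberg 1989 §3 Cor. 2 / Kitajima–Otsuki Prop. 3.29; displayed): `Ker Col♭ = Λ ∙ z♭`.
NO Honda clause.  (`2 ∣ a₂` from `GoodSS`.)  [cite: KitajimaOtsuki2018, Prop. 3.29 and Prop. 3.32 (arXiv:1607.03612 p. 16)]
[cite: Sprung2012, Def. 7.9 (p. 1503), proof of Prop. 7.3 (p. 1500)] -/
theorem exists_colemanKer_flat_eq_span_of_linearEquiv_fin_two_rat (hss : GoodSS W 2) (κ : ZpExtension ℚ 2)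
    (hv : (2 : 𝓞 ℚ) ∈ v.asIdeal)
    {g : Field.absoluteGaloisGroup (v.adicCompletion ℚ)} {c : ℕ → localPoints W (v.adicCompletion ℚ)}
    (hg : κ.IsTopGenerator (resGalOfEmb (closureEmb (K := ℚ) (v.adicCompletion ℚ)) g))
    (hc : ∀ n, c n ∈ localLayerPointsOfEmb κ (closureEmb (K := ℚ) (v.adicCompletion ℚ)) W n)
    (htr : ∀ n, 1 ≤ n → localTraceOfEmb κ (closureEmb (K := ℚ) (v.adicCompletion ℚ)) W n (n + 1)
      (c (n + 1)) = W.frobeniusTrace 2 • c n - c (n - 1))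
    (hz : ∀ z₀ : localLayerPointsOfEmb κ (closureEmb (K := ℚ) (v.adicCompletion ℚ)) W 0 →+ ℤ_[2],
      evalOn W (localLayerPointsOfEmb κ (closureEmb (K := ℚ) (v.adicCompletion ℚ)) W 0) z₀ (c 0) = 0 → z₀ = 0)
    (hsat : ∀ a : ℤ_[2],
      (∃ z₀ : localLayerPointsOfEmb κ (closureEmb (K := ℚ) (v.adicCompletion ℚ)) W 0 →+ ℤ_[2],
        evalOn W (localLayerPointsOfEmb κ (closureEmb (K := ℚ) (v.adicCompletion ℚ)) W 0) z₀ (c 0) = 2 * a) →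
      ∃ y : localLayerPointsOfEmb κ (closureEmb (K := ℚ) (v.adicCompletion ℚ)) W 0 →+ ℤ_[2],
        evalOn W (localLayerPointsOfEmb κ (closureEmb (K := ℚ) (v.adicCompletion ℚ)) W 0) y (c 0) = a)
    (e : letI := moduleOfGenerator κ (closureEmb (K := ℚ) (v.adicCompletion ℚ)) W hg
      (localTowerPointsOfEmb κ (closureEmb (K := ℚ) (v.adicCompletion ℚ)) W →+ ℤ_[2]) ≃ₗ[IwasawaAlgebra 2]
        (Fin 2 → IwasawaAlgebra 2)) :
    letI := moduleOfGenerator κ (closureEmb (K := ℚ) (v.adicCompletion ℚ)) W hg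
    ∃ zf : localTowerPointsOfEmb κ (closureEmb (K := ℚ) (v.adicCompletion ℚ)) W →+ ℤ_[2],
      colemanKer κ (closureEmb (K := ℚ) (v.adicCompletion ℚ)) W (W.frobeniusTrace 2) g c .flat =
        (Submodule.span (IwasawaAlgebra 2) {zf} : Set _) := by
  obtain ⟨z, hz2⟩ := exists_addMonoidHom_not_two_dvd_apply W hss κ hv (closureEmb (K := ℚ) (v.adicCompletion ℚ))
    (hc 0) hz hsat
  have hzne : z ⟨c 0, localLayerPointsOfEmb_le_localTowerPointsOfEmb κ _ W 0 (hc 0)⟩ ≠ 0 :=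
    fun h0 ↦ hz2 (by rw [h0]; exact dvd_zero _)
  have hap : ((2 : ℕ) : ℤ) ∣ W.frobeniusTrace 2 := by exact_mod_cast hss.2
  exact exists_colemanKer_flat_eq_span_of_linearEquiv_fin_two_of_apply_ne_zero hg hap hc htr e ⟨z, hzne⟩

end OddBlindNF

end Summit.BirchSwinnertonDyer.BirchSwinnertonDyer.Theorems

end
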